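import Mathlib
import HarnessLib
import Literature.Probability.ImportanceSampling.OptimalImportanceDistribution
import Summits.Ventures.LatticeQCDFlow.Exactness.QuasiStaticDissipation
import Summits.Ventures.LatticeQCDFlow.Scaling.VarianceLaws

/-!
# LinearFamilyTilt — exponential tilts inside the linear Gibbs family `S_c = S₀ + c·D`:
# reweighting factors, the tilt identity `π_{c+a} = T_{e^{−aD}} π_c`, the one-step reweighting ESS
# `ESS(π_{c'}, π_c) = Z(c')²/(Z(c)Z(2c'−c))`, and `√Var_π(g) = π[g]·√χ²(T_g π ‖ π)`

HONEST FRAMING: exact (Metropolis-corrected) sampling algorithms for lattice gauge theory;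
figures of merit are autocorrelation/cost numbers at stated couplings and volumes; no
continuum-physics claim.

Venture `LatticeQCDFlow` (cell pub-lqcd), topic `Scaling`; FANOUT row 19 (`su2-snf`, GEN-6).
OUR WORK (elementary finite sums), nothing here is cited as a fact.  Vocabulary: row 8's
`linAction S₀ D c = S₀ + c•D`, `gibbsLaw`, `partitionFn` (`Exactness/…`), theory-2's `essFrac`,
`weight`, `varLaw` (`Scaling/ImportanceWeights`, `Scaling/VarianceLaws`) and the Literature's Pearson
`chiSqDiv μ π = Σ (μ − π)²/π` (Agapiou et al. 2017, as printed).  These identities are the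
model-side input of the tilted (second-moment) recursion behind the general-layer ESS floor
(`Scaling/TiltedLinearProtocol`, `Scaling/GeneralLayerESSFloor`, this seat):

* `sum_gibbsLaw_linAction_mul_exp` — `Σ_x π_c(x) e^{−aD(x)} = Z(c+a)/Z(c)` (positive,
  `sum_gibbsLaw_linAction_mul_exp_pos`);
* `gibbsLaw_linAction_add` — THE TILT IDENTITY `π_{c+a} = e^{−aD}·π_c / π_c[e^{−aD}]`: moving along
  the family IS tilting by a one-time weight;
* `essFrac_gibbsLaw_linAction` — `ESS(π_{c'}, π_c) = Z(c')²/(Z(2c'−c)·Z(c))`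
  (`E_{π_c}[(π_{c'}/π_c)²] = Z(2c'−c)Z(c)/Z(c')²`): the perfect-relaxation factors telescope against
  the tilted reweighting factors `Z(c+2δ)/Z(c)`;
* `sqrt_varLaw_eq_mul_sqrt_chiSqDiv` — for a positive probability vector `π` and a weight `g` with
  `π[g] > 0`: `√Var_π(g) = π[g]·√χ²(T_g π ‖ π)`, `T_g π = g·π/π[g]` — the relative standard
  deviation of a weight IS the `χ²`-distance of the tilted law;
* two scalar helpers: `exp_three_halves_add_le` (`e^{3M/2} + e^{M}y ≤ e^{3M}` for `0 ≤ y`,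
  `y² ≤ 2M²`) and `uniform_step` (`(k+1)/n − k/n = 1/n`).

NOT CLAIMED: anything about layers or paths (see the two files above).
-/

namespace Summit.Ventures.LatticeQCDFlow.Scaling

open Finset
open Literature.Probability.ImportanceSampling (chiSqDiv chiSqDiv_def chiSqDiv_eq_sum_sq_div)
open Summit.Ventures.LatticeQCDFlow.Exactness
open Summit.Ventures.LatticeQCDFlow.Theory2

variable {X : Type*} [Fintype X]

/-! ## Identities of the linear Gibbs family -/

section Family

variable [Nonempty X]

/-- Reweighting inside the linear family: `Σ_x π_c(x) e^{−a D(x)} = Z(c + a)/Z(c)`. -/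
theorem sum_gibbsLaw_linAction_mul_exp (S₀ D : X → ℝ) (c a : ℝ) :
    ∑ x, gibbsLaw (linAction S₀ D c) x * Real.exp (-(a * D x))
      = partitionFn (linAction S₀ D (c + a)) / partitionFn (linAction S₀ D c) := by
  rw [← sum_gibbsLaw_mul_exp_neg_sub (linAction S₀ D c) (linAction S₀ D (c + a))]
  refine sum_congr rfl fun x _ => ?_
  rw [show -(a * D x) = -(linAction S₀ D (c + a) x - linAction S₀ D c x) by
    simp only [linAction]; ring]

/-- The reweighting factor is positive. -/
theorem sum_gibbsLaw_linAction_mul_exp_pos (S₀ D : X → ℝ) (c a : ℝ) :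
    0 < ∑ x, gibbsLaw (linAction S₀ D c) x * Real.exp (-(a * D x)) :=
  sum_pos (fun x _ => mul_pos (gibbsLaw_pos _ x) (Real.exp_pos _)) univ_nonempty

/-- **Tilt identity**: `π_{c+a} = e^{−aD}·π_c / π_c[e^{−aD}]` — moving along the family IS
tilting by the one-time weight. -/
theorem gibbsLaw_linAction_add (S₀ D : X → ℝ) (c a : ℝ) (x : X) :
    gibbsLaw (linAction S₀ D (c + a)) x
      = gibbsLaw (linAction S₀ D c) x * Real.exp (-(a * D x))
          / ∑ y, gibbsLaw (linAction S₀ D c) y * Real.exp (-(a * D y)) := by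
  rw [sum_gibbsLaw_linAction_mul_exp,
    eq_div_iff (div_pos (partitionFn_pos _) (partitionFn_pos _)).ne']
  have hZ := (partitionFn_pos (linAction S₀ D c)).ne'
  have hZ' := (partitionFn_pos (linAction S₀ D (c + a))).ne'
  have he : Real.exp (-(linAction S₀ D (c + a) x))
      = Real.exp (-(linAction S₀ D c x)) * Real.exp (-(a * D x)) := by
    rw [← Real.exp_add]; congr 1; simp only [linAction]; ring
  unfold gibbsLaw
  rw [he]
  field_simp

/-- **The one-step reweighting ESS inside the family**: `ESS(π_{c'}, π_c) = Z(c')²/(Z(c)·Z(2c'−c))`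
(`E_{π_c}[(π_{c'}/π_c)²] = Z(2c'−c)Z(c)/Z(c')²`). -/
theorem essFrac_gibbsLaw_linAction (S₀ D : X → ℝ) (c c' : ℝ) :
    essFrac (gibbsLaw (linAction S₀ D c')) (gibbsLaw (linAction S₀ D c))
      = partitionFn (linAction S₀ D c') ^ 2
          / (partitionFn (linAction S₀ D (2 * c' - c)) * partitionFn (linAction S₀ D c)) := by
  have hZ := (partitionFn_pos (linAction S₀ D c)).ne'
  have hZ' := (partitionFn_pos (linAction S₀ D c')).ne'
  have hZ2 := (partitionFn_pos (linAction S₀ D (2 * c' - c))).ne'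
  rw [essFrac_eq_inv (gibbsLaw_pos _) (sum_gibbsLaw _)]
  have hsum : ∑ x, gibbsLaw (linAction S₀ D c') x
        * weight (gibbsLaw (linAction S₀ D c')) (gibbsLaw (linAction S₀ D c)) x
      = partitionFn (linAction S₀ D (2 * c' - c)) * partitionFn (linAction S₀ D c)
          / partitionFn (linAction S₀ D c') ^ 2 := by
    have hterm : ∀ x, gibbsLaw (linAction S₀ D c') x
          * weight (gibbsLaw (linAction S₀ D c')) (gibbsLaw (linAction S₀ D c)) x
        = Real.exp (-(linAction S₀ D (2 * c' - c) x))
            * (partitionFn (linAction S₀ D c) / partitionFn (linAction S₀ D c') ^ 2) := by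
      intro x
      have hexp : Real.exp (-(linAction S₀ D (2 * c' - c) x))
          = Real.exp (-(linAction S₀ D c' x)) * Real.exp (-(linAction S₀ D c' x))
              / Real.exp (-(linAction S₀ D c x)) := by
        rw [eq_div_iff (Real.exp_pos _).ne', ← Real.exp_add, ← Real.exp_add]
        congr 1; simp only [linAction]; ring
      unfold weight gibbsLaw
      rw [hexp]
      field_simp
    simp_rw [hterm]
    rw [← sum_mul]
    unfold partitionFn
    field_simp
  rw [hsum]
  field_simp

omit [Nonempty X] in
/-- `√Var_π(g) = π[g]·√χ²(T_g π ‖ π)` for a positive probability vector `π` and a weight `g` with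
`π[g] > 0`, `T_g π = g·π/π[g]`: the relative standard deviation of the weight IS the `χ²`-distance of
the tilted law. -/
theorem sqrt_varLaw_eq_mul_sqrt_chiSqDiv {π g : X → ℝ} (hπ : ∀ x, 0 < π x) (hπ1 : ∑ x, π x = 1)
    (hg : 0 < ∑ x, π x * g x) :
    Real.sqrt (varLaw π g)
      = (∑ x, π x * g x) * Real.sqrt (chiSqDiv (fun x => π x * g x / ∑ y, π y * g y) π) := by
  set gbar := ∑ x, π x * g x with hgbar
  have hvar : varLaw π g = gbar ^ 2 * chiSqDiv (fun x => π x * g x / gbar) π := by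
    rw [varLaw_eq_sum_sq_dev hπ1, ← hgbar, chiSqDiv_eq_sum_sq_div, mul_sum]
    refine sum_congr rfl fun x _ => ?_
    field_simp [(hπ x).ne', hg.ne']
  rw [hvar, Real.sqrt_mul (sq_nonneg _), Real.sqrt_sq hg.le]

end Family

/-! ## Scalar helpers -/

/-- `e^{3M/2} + e^{M}·y ≤ e^{3M}` whenever `M ≥ 0`, `y ≥ 0`, `y² ≤ 2M²` (`y ≤ 3M/2` and
`1 + 3M/2 ≤ e^{3M/2}`): folds the relative standard deviation of the weight into the contraction
factor. -/
theorem exp_three_halves_add_le {M y : ℝ} (hM : 0 ≤ M) (hy : 0 ≤ y) (hy2 : y ^ 2 ≤ 2 * M ^ 2) :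
    Real.exp (3 * M / 2) + Real.exp M * y ≤ Real.exp (3 * M) := by
  have hy' : y ≤ 3 * M / 2 := by
    have h : y ^ 2 ≤ (3 * M / 2) ^ 2 := hy2.trans (by nlinarith)
    exact (pow_le_pow_iff_left₀ hy (by linarith) two_ne_zero).mp h
  have hE1 : Real.exp M ≤ Real.exp (3 * M / 2) := Real.exp_le_exp.mpr (by linarith)
  have hE2 : 1 + 3 * M / 2 ≤ Real.exp (3 * M / 2) := by
    linarith [Real.add_one_le_exp (3 * M / 2)]
  have hE3 : Real.exp (3 * M) = Real.exp (3 * M / 2) * Real.exp (3 * M / 2) := by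
    rw [← Real.exp_add]; congr 1; ring
  have hpos := Real.exp_pos (3 * M / 2)
  calc Real.exp (3 * M / 2) + Real.exp M * y
      ≤ Real.exp (3 * M / 2) + Real.exp (3 * M / 2) * (3 * M / 2) := by
        nlinarith [mul_le_mul hE1 hy' hy hpos.le]
    _ = Real.exp (3 * M / 2) * (1 + 3 * M / 2) := by ring
    _ ≤ Real.exp (3 * M) := by
        rw [hE3]; exact mul_le_mul_of_nonneg_left hE2 hpos.le

/-- Steps of the uniform grid. -/
theorem uniform_step (n k : ℕ) : ((k + 1 : ℕ) : ℝ) / n - (k : ℝ) / n = 1 / n := by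
  rw [← sub_div]; push_cast; ring

end Summit.Ventures.LatticeQCDFlow.Scaling
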